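import Literature.MathematicalPhysics.QuantumLattice.HubbardFreeTorusGroundEnergy
import Literature.MathematicalPhysics.QuantumLattice.TorusBandEdgeCounting
import Literature.MathematicalPhysics.QuantumLattice.HubbardGrandCanonicalDensity

/-!
# A uniform chemical-potential window for the weakly interacting Hubbard torus at densities in `[3/5, 9/10]`

Topic `MathematicalPhysics/QuantumLattice` (family `hubbard`). Written for the support item
`TwPureThermalBound` (route `HubbardSuperconductivity/ThermalWedge`), whose claim quantifies
`∃ μ₁ μ₂, -4 < μ₁ ≤ μ₂ < 0` BEFORE `∀ U ≤ U₀`: the chemical potential produced by the convexity /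
equivalence-of-ensembles argument (a subgradient of the canonical ground-energy density at density
`n* = 1 - δ ∈ [3/5, 9/10]`) has to be localised uniformly in `U` and `L`. With
`K^U_μ := hubbardTorusWith 2 L 1 U μ` we PROVE the finite-volume inequalities that do this:

* `groundEnergy_free_upperEdge` / `groundEnergy_upperEdge` (`L ≥ 400`, `0 ≤ U`): for
  `μ_hi := -cos²(49π/100) ≤ μ' ≤ μ`,  `E₀(K^U_μ) ≤ E₀(K^U_{μ'}) - (μ - μ')(19/20)L² + U L²`
  (free density `≥ 19/20` below the band centre, `TorusBandEdgeCounting`, the free secant inequality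
  `HubbardFreeTorusGroundEnergy`, and the interaction sandwich `groundEnergy_torus_sub_free_mem_Icc`);
* `groundEnergy_free_lowerEdge` / `groundEnergy_lowerEdge` (`L ≥ 4`): for `μ ≤ μ'' ≤ μ_lo := -15/4`,
  `E₀(K^U_μ) ≤ E₀(K^U_{μ''}) + (μ'' - μ)(1/2)L² + U L²` (free density `≤ 1/2` above the band bottom);
* `chemicalPotential_mem_window`: consequently, if `μ` is an `ηL²`-approximate supergradient point of
  slope `-n*`, `n* ∈ [3/5, 9/10]`, of `μ' ↦ E₀(K^U_{μ'})` tested at the two points `μ_hi`, `μ_lo`, then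
  `-15/4 - 10(U + η) ≤ μ ≤ -cos²(49π/100) + 20(U + η)` — a window inside `(-4, 0)` as soon as
  `U + η` is small, uniformly in `L ≥ 400` and in `n*` (`window_subset_Ioo`); asymptotic form
  `chemicalPotential_mem_window_of_forall` (slack `η → 0` along tori `L ≥ 400`).

Everything is proved; no definition and no named fact. [folklore]

## References

* D. Ruelle, *Statistical Mechanics: Rigorous Results* (Benjamin, 1969), §3.4 (density as a function of
  the chemical potential; equivalence of ensembles). [folklore use]
-/

noncomputable section

namespace Literature.MathematicalPhysics.QuantumLattice

open Matrix Finset Real Literature.Probability.LatticeModels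

variable {L : ℕ} [NeZero L]

/-- **Upper-edge secant inequality for the free torus** (`L ≥ 400`): with `μ_hi := -cos²(49π/100) < 0`,
for all `μ_hi ≤ μ' ≤ μ`,  `E₀(K⁰_μ) ≤ E₀(K⁰_{μ'}) - (μ - μ') · (19/20) L²`, `K⁰_μ = hubbardTorusWith 2 L 1 0 μ`
(the free gas has density `≥ 19/20` at every `μ' ≥ μ_hi`). [folklore] -/
theorem groundEnergy_free_upperEdge (hL : 400 ≤ L) {μ μ' : ℝ}
    (h1 : -Real.cos (49 * π / 100) ^ 2 ≤ μ') (h2 : μ' ≤ μ) :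
    (hubbardTorusWith 2 L 1 0 μ).groundEnergy ≤
      (hubbardTorusWith 2 L 1 0 μ').groundEnergy - (μ - μ') * (19 / 20 * (L : ℝ) ^ 2) := by
  have hL3 : 3 ≤ L := le_trans (by norm_num) hL
  have hsec := groundEnergy_free_le_sub_card hL3 h2
  have hsub : (Finset.univ.filter fun k : TorusSite 2 L => torusBand L k < -Real.cos (49 * π / 100) ^ 2) ⊆
      Finset.univ.filter fun k : TorusSite 2 L => torusBand L k < μ' := fun k hk => by
    rw [Finset.mem_filter] at hk ⊢; exact ⟨hk.1, hk.2.trans_le h1⟩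
  have hmono : ((Finset.univ.filter fun k : TorusSite 2 L => torusBand L k < -Real.cos (49 * π / 100) ^ 2).card : ℝ)
      ≤ ((Finset.univ.filter fun k : TorusSite 2 L => torusBand L k < μ').card : ℝ) := by
    exact_mod_cast Finset.card_le_card hsub
  have hcount := card_filter_torusBand_lt_upperEdge hL
  have hμμ' : 0 ≤ μ - μ' := by linarith
  nlinarith

/-- **Lower-edge secant inequality for the free torus** (`L ≥ 4`): with `μ_lo := -15/4`, for all
`μ ≤ μ'' ≤ μ_lo`,  `E₀(K⁰_μ) ≤ E₀(K⁰_{μ''}) + (μ'' - μ) · (1/2) L²` (the free gas has density `≤ 1/2` at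
every `μ'' ≤ μ_lo`). [folklore] -/
theorem groundEnergy_free_lowerEdge (hL : 4 ≤ L) {μ μ'' : ℝ} (h1 : μ ≤ μ'') (h2 : μ'' ≤ -15 / 4) :
    (hubbardTorusWith 2 L 1 0 μ).groundEnergy ≤
      (hubbardTorusWith 2 L 1 0 μ'').groundEnergy + (μ'' - μ) * (1 / 2 * (L : ℝ) ^ 2) := by
  have hL3 : 3 ≤ L := le_trans (by norm_num) hL
  have hsec := groundEnergy_free_le_add_card hL3 h1
  have hsub : (Finset.univ.filter fun k : TorusSite 2 L => torusBand L k < μ'') ⊆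
      Finset.univ.filter fun k : TorusSite 2 L => torusBand L k < -15 / 4 := fun k hk => by
    rw [Finset.mem_filter] at hk ⊢; exact ⟨hk.1, hk.2.trans_le h2⟩
  have hmono : ((Finset.univ.filter fun k : TorusSite 2 L => torusBand L k < μ'').card : ℝ)
      ≤ ((Finset.univ.filter fun k : TorusSite 2 L => torusBand L k < -15 / 4).card : ℝ) := by
    exact_mod_cast Finset.card_le_card hsub
  have hcount := card_filter_torusBand_lt_lowerEdge hL
  have hμμ' : 0 ≤ μ'' - μ := by linarith
  nlinarith

/-- **Upper-edge secant inequality, interacting torus** (`0 ≤ U`, `L ≥ 400`): for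
`μ_hi ≤ μ' ≤ μ`, `E₀(K^U_μ) ≤ E₀(K^U_{μ'}) - (μ - μ')(19/20)L² + U L²`, `K^U_μ = hubbardTorusWith 2 L 1 U μ`
(the interaction shifts ground energies by at most `U L²`, `groundEnergy_torus_sub_free_mem_Icc`). [folklore] -/
theorem groundEnergy_upperEdge {U : ℝ} (hU : 0 ≤ U) (hL : 400 ≤ L) {μ μ' : ℝ}
    (h1 : -Real.cos (49 * π / 100) ^ 2 ≤ μ') (h2 : μ' ≤ μ) :
    (hubbardTorusWith 2 L 1 U μ).groundEnergy ≤
      (hubbardTorusWith 2 L 1 U μ').groundEnergy - (μ - μ') * (19 / 20 * (L : ℝ) ^ 2) + U * (L : ℝ) ^ 2 := by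
  have hfree := groundEnergy_free_upperEdge hL h1 h2
  have hμ := groundEnergy_torus_sub_free_mem_Icc L 1 μ hU
  have hμ' := groundEnergy_torus_sub_free_mem_Icc L 1 μ' hU
  rw [Set.mem_Icc] at hμ hμ'
  linarith [hμ.2, hμ'.1]

/-- **Lower-edge secant inequality, interacting torus** (`0 ≤ U`, `L ≥ 4`): for `μ ≤ μ'' ≤ μ_lo = -15/4`,
`E₀(K^U_μ) ≤ E₀(K^U_{μ''}) + (μ'' - μ)(1/2)L² + U L²`. [folklore] -/
theorem groundEnergy_lowerEdge {U : ℝ} (hU : 0 ≤ U) (hL : 4 ≤ L) {μ μ'' : ℝ} (h1 : μ ≤ μ'')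
    (h2 : μ'' ≤ -15 / 4) :
    (hubbardTorusWith 2 L 1 U μ).groundEnergy ≤
      (hubbardTorusWith 2 L 1 U μ'').groundEnergy + (μ'' - μ) * (1 / 2 * (L : ℝ) ^ 2) + U * (L : ℝ) ^ 2 := by
  have hfree := groundEnergy_free_lowerEdge hL h1 h2
  have hμ := groundEnergy_torus_sub_free_mem_Icc L 1 μ hU
  have hμ' := groundEnergy_torus_sub_free_mem_Icc L 1 μ'' hU
  rw [Set.mem_Icc] at hμ hμ'
  linarith [hμ.2, hμ'.1]

/-- **The uniform window.** Let `L ≥ 400`, `0 ≤ U`, `0 ≤ η`, `n* ∈ [3/5, 9/10]`, and suppose `μ` is an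
approximate supergradient point of slope `-n* L²` of `μ' ↦ E₀(K^U_{μ'})` with slack `ηL²`, tested at the
two band-edge points: `E₀(K^U_{μ'}) ≤ E₀(K^U_μ) - (μ' - μ) n* L² + ηL²` for `μ' ∈ {μ_hi, μ_lo}`
(`μ_hi = -cos²(49π/100)`, `μ_lo = -15/4`). Then `μ_lo - 10(U + η) ≤ μ ≤ μ_hi + 20(U + η)`: the free gas
is too dense above `μ_hi` and too dilute below `μ_lo` for `μ` to support density `n*` there. [folklore] -/
theorem chemicalPotential_mem_window {U η n μ : ℝ} (hU : 0 ≤ U) (hη : 0 ≤ η) (hL : 400 ≤ L)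
    (hn1 : 3 / 5 ≤ n) (hn2 : n ≤ 9 / 10)
    (hhi : (hubbardTorusWith 2 L 1 U (-Real.cos (49 * π / 100) ^ 2)).groundEnergy ≤
      (hubbardTorusWith 2 L 1 U μ).groundEnergy - (-Real.cos (49 * π / 100) ^ 2 - μ) * (n * (L : ℝ) ^ 2) +
        η * (L : ℝ) ^ 2)
    (hlo : (hubbardTorusWith 2 L 1 U (-15 / 4)).groundEnergy ≤
      (hubbardTorusWith 2 L 1 U μ).groundEnergy - (-15 / 4 - μ) * (n * (L : ℝ) ^ 2) + η * (L : ℝ) ^ 2) :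
    -15 / 4 - 10 * (U + η) ≤ μ ∧ μ ≤ -Real.cos (49 * π / 100) ^ 2 + 20 * (U + η) := by
  have hLr : (400 : ℝ) ≤ L := by exact_mod_cast hL
  have hL2 : (0 : ℝ) < (L : ℝ) ^ 2 := by positivity
  have hL4 : 4 ≤ L := le_trans (by norm_num) hL
  have hUη : 0 ≤ U + η := add_nonneg hU hη
  constructor
  · -- lower edge
    rcases le_or_gt μ (-15 / 4) with hμlo | hμlo
    · have hedge := groundEnergy_lowerEdge hU hL4 hμlo le_rfl
      -- add the two inequalities: `(μ_lo - μ)(n - 1/2) L² ≤ (U + η) L²`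
      have hsum : (-15 / 4 - μ) * (n - 1 / 2) * (L : ℝ) ^ 2 ≤ (U + η) * (L : ℝ) ^ 2 := by nlinarith
      have h1 : (-15 / 4 - μ) * (n - 1 / 2) ≤ U + η := le_of_mul_le_mul_right hsum hL2
      nlinarith
    · linarith
  · -- upper edge
    rcases le_or_gt (-Real.cos (49 * π / 100) ^ 2) μ with hμhi | hμhi
    · have hedge := groundEnergy_upperEdge hU hL (le_refl (-Real.cos (49 * π / 100) ^ 2)) hμhi
      have hsum : (μ - -Real.cos (49 * π / 100) ^ 2) * (19 / 20 - n) * (L : ℝ) ^ 2 ≤ (U + η) * (L : ℝ) ^ 2 := by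
        nlinarith
      have h1 : (μ - -Real.cos (49 * π / 100) ^ 2) * (19 / 20 - n) ≤ U + η := le_of_mul_le_mul_right hsum hL2
      nlinarith
    · linarith

/-- The window is inside `(-4, 0)` and non-degenerate when `U + η` is small: e.g. for
`U + η ≤ cos²(49π/100)/50` its upper end is `≤ -(3/5)cos²(49π/100) < 0` and its lower end is `> -4`. [folklore] -/
theorem window_subset_Ioo {U η : ℝ} (hU : 0 ≤ U) (hη : 0 ≤ η)
    (hsmall : U + η ≤ Real.cos (49 * π / 100) ^ 2 / 50) :
    -4 < -15 / 4 - 10 * (U + η) ∧ -15 / 4 - 10 * (U + η) ≤ -Real.cos (49 * π / 100) ^ 2 + 20 * (U + η) ∧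
      -Real.cos (49 * π / 100) ^ 2 + 20 * (U + η) < 0 := by
  have hc0 : 0 < Real.cos (49 * π / 100) := by
    apply Real.cos_pos_of_mem_Ioo; constructor <;> nlinarith [Real.pi_pos]
  have hc1 : Real.cos (49 * π / 100) ^ 2 ≤ 1 := by
    have := Real.abs_cos_le_one (49 * π / 100)
    have h := sq_abs (Real.cos (49 * π / 100))
    nlinarith [abs_nonneg (Real.cos (49 * π / 100))]
  have hc2 : 0 < Real.cos (49 * π / 100) ^ 2 := pow_pos hc0 2
  refine ⟨by nlinarith, by nlinarith, by nlinarith⟩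

/-- **The uniform window, asymptotic form.** If for every slack `η > 0` some torus of side `L ≥ 400`
realises the two approximate supergradient inequalities of `chemicalPotential_mem_window` (e.g. by
pointwise convergence of `L⁻² E₀(K^U_{μ'})` at the three points `μ', μ_hi, μ_lo` to a concave limit with
supergradient `-n` at `μ`), then `-15/4 - 10U ≤ μ ≤ -cos²(49π/100) + 20U`. [folklore] -/
theorem chemicalPotential_mem_window_of_forall {U n μ : ℝ} (hU : 0 ≤ U) (hn1 : 3 / 5 ≤ n) (hn2 : n ≤ 9 / 10)
    (h : ∀ η : ℝ, 0 < η → ∃ L : ℕ, 400 ≤ L ∧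
      (hubbardTorusWith 2 L 1 U (-Real.cos (49 * π / 100) ^ 2)).groundEnergy ≤
        (hubbardTorusWith 2 L 1 U μ).groundEnergy - (-Real.cos (49 * π / 100) ^ 2 - μ) * (n * (L : ℝ) ^ 2) +
          η * (L : ℝ) ^ 2 ∧
      (hubbardTorusWith 2 L 1 U (-15 / 4)).groundEnergy ≤
        (hubbardTorusWith 2 L 1 U μ).groundEnergy - (-15 / 4 - μ) * (n * (L : ℝ) ^ 2) + η * (L : ℝ) ^ 2) :
    -15 / 4 - 10 * U ≤ μ ∧ μ ≤ -Real.cos (49 * π / 100) ^ 2 + 20 * U := by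
  have key : ∀ η : ℝ, 0 < η → -15 / 4 - 10 * (U + η) ≤ μ ∧ μ ≤ -Real.cos (49 * π / 100) ^ 2 + 20 * (U + η) := by
    intro η hη
    obtain ⟨L, hL, hhi, hlo⟩ := h η hη
    haveI : NeZero L := ⟨by omega⟩
    exact chemicalPotential_mem_window hU hη.le hL hn1 hn2 hhi hlo
  constructor
  · -- `μ ≥ -15/4 - 10U - 10η` for all `η > 0`
    refine le_of_forall_pos_lt_add fun ε hε => ?_
    have := (key (ε / 20) (by positivity)).1
    linarith
  · refine le_of_forall_pos_lt_add fun ε hε => ?_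
    have := (key (ε / 40) (by positivity)).2
    linarith

end Literature.MathematicalPhysics.QuantumLattice

end
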